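import Summits.Langlands.Langlands.Theorems.IrreducibilityBySelfDualityReciprocityUpToIrreducibilityRReconstruction
import Summits.Langlands.Langlands.Theorems.IrreducibilityBySelfDualityReciprocityUpToIrreducibilityRDualProbes
import Summits.Langlands.Langlands.Theorems.IrreducibilityBySelfDualityReciprocityUpToIrreducibilityRInvariantsHomDual
import Summits.Langlands.Langlands.Theorems.IrreducibilityBySelfDualityReciprocityUpToIrreducibilityRProbeModel
import Summits.Langlands.Langlands.Theorems.IrreducibilityBySelfDualityReciprocityUpToIrreducibilityRPoleOrderInvariants
import Literature.NumberTheory.GaloisRepresentations.HenniartGaloisSideCharacterisation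
import HarnessLib

/-!
# Henniart 2002, Thm 1.7 (a), Galois side, invariant form — STUB S-17a-B of line `Sketch`
# (crux stmt-Langlands-17925 `IrreducibilityBySelfDuality.ReciprocityUpToIrreducibilityR`), part 2: the case analysis

**Reconstruction** (`isEquivalent_ofSubrep_of_K_eq`): two sub-Weil–Deligne representations `U ≤ σ`,
`U' ≤ σ'` of Frobenius-semisimple `σ, σ'` with the same `Hom`-counts
`K_U(ρ, d) = dim Hom_WD(ρ ⊗ Sp(d), σ; U)` against every standard string are isomorphic: peel off a string
summand `string(H, e)` of `U`; the count `c_{U'}(ρ_H, e) = c_U(ρ_H, e) ≥ 1` locates a matching string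
summand of `U'` (`…RStringCounting`); the complements have the same counts, induction, and gluing
(`…RStringIso`, `…RGluing`).  Then the registered stub `stub_isEquivalent_of_finrank_invariants_tprod_eq`
(Henniart, Bull. SMF 130 (2002), Thm 1.7 (a) in invariant form): the hypothesis gives equal counts for
ADMISSIBLE probes (`dim ρ ⊗ Sp(d) < n`; `…RInvariantsHomDual`, `…RDualProbes`, `…RProbeModel`); if both
`σ, σ'` are decomposable every string has dimension `≤ n - 1` and the counts stabilise beyond the
admissible range (`K_stable`), so reconstruction applies; if one of them is a single string `ρ_H ⊗ Sp(e)`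
(`e ≥ 2` on the `σ`-side, as `σ` is not irreducible), the socle probe `ρ_H ⊗ ‖·‖^{e-1}` of dimension
`< n` forces the other to be the same string (and rules out the decomposable / irreducible alternatives).
No definitions; standard axioms only.
-/

noncomputable section

set_option linter.dupNamespace false

open Module Polynomial
open Literature.NumberTheory.Automorphic Literature.NumberTheory.GaloisRepresentations
open Literature.NumberTheory.GaloisRepresentations.WeilGroup
open Literature.NumberTheory.GaloisRepresentations.IsNonarchimedeanLocalField

namespace Summit.Langlands.Langlands.Theorems.ReciprocityUpToIrreducibilityR

variable {F : Type} [Field F] [ValuativeRel F] [TopologicalSpace F] [IsNonarchimedeanLocalField F]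

/-! ## Admissible probes and the case analysis -/

section Final

variable {n : ℕ}

/-- **Admissible probes.**  The hypothesis of Thm 1.7 (a) (equal dimensions of the Weil–Deligne
invariants of `σ ⊗ τ`, `σ' ⊗ τ` for indecomposable Frobenius-semisimple `τ` of dimension `< n`) gives
equal counts `K_⊤(ρ, d)` for every standard string `ρ ⊗ Sp(d)` of dimension `d · dim ρ < n`
(`…RInvariantsHomDual`, `…RDualProbes`, `…RProbeModel`). [cite: HenniartBSMF2002, Thm. 1.7 (a)] -/
theorem K_top_eq_of_hyp {σ σ' : WeilDeligneRep F ℂ (Fin n → ℂ)}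
    (H : ∀ (r : ℕ), 0 < r → r < n → ∀ τ : WeilDeligneRep F ℂ (Fin r → ℂ), τ.IsFrobSemisimple →
      τ.IsIndecomposable → finrank ℂ ↥(LinearMap.ker (σ.tprod τ).N ⊓ (σ.tprod τ).ρ.invariants) =
        finrank ℂ ↥(LinearMap.ker (σ'.tprod τ).N ⊓ (σ'.tprod τ).ρ.invariants))
    (Hp : Type) [AddCommGroup Hp] [Module ℂ Hp] [FiniteDimensional ℂ Hp] [Nontrivial Hp]
    (ρ : Representation ℂ (WeilGroup F) Hp) (hρ : WeilGroup.IsContinuousRep ρ) (hirr : ρ.IsIrreducible)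
    (hss : ∀ w, Module.End.IsSemisimple (ρ w)) {d : ℕ} (hd : 0 < d) (hlt : d * finrank ℂ Hp < n) :
    finrank ℂ (homWDIn (stringModel ρ hρ d) σ ⊤) = finrank ℂ (homWDIn (stringModel ρ hρ d) σ' ⊤) := by
  rw [homWDIn_top, homWDIn_top]
  haveI := hirr
  obtain ⟨hfs, hind⟩ := stub_stringModel_isFrobSemisimple_isIndecomposable F Hp ρ hρ hss d hd
  refine stub_finrank_homWD_eq_of_dual_probes F IsFrobPow.mul_holds IsFrobPow.unique_holds _ _ σ σ' n
    ?_ (Fin d → Hp) (stringModel ρ hρ d) hfs hind ?_ ?_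
  · intro r hr hrn τ hτ hτi
    rw [← stub_finrank_invariants_tprod_eq_finrank_homWD_dual F _ _ _ _ σ τ,
      ← stub_finrank_invariants_tprod_eq_finrank_homWD_dual F _ _ _ _ σ' τ]
    exact H r hr hrn τ hτ hτi
  · rw [finrank_fin_fun']; exact Nat.mul_pos hd finrank_pos
  · rw [finrank_fin_fun']; exact hlt

/-- **A single string and a decomposable representation never have the same admissible counts**: the
socle probes of two string summands sitting in complementary pieces of the decomposable one would both be
the socle of the single string, hence isomorphic, and then the decomposable side counts `≥ 2` where the
string counts `≤ 1`. [cite: HenniartBSMF2002, §4] -/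
theorem false_of_string_of_decomposable {V₁ V₂ : Type} [AddCommGroup V₁] [Module ℂ V₁] [FiniteDimensional ℂ V₁]
    [AddCommGroup V₂] [Module ℂ V₂] [FiniteDimensional ℂ V₂] {σ₁ : WeilDeligneRep F ℂ V₁}
    {σ₂ : WeilDeligneRep F ℂ V₂} (hσ₂ : σ₂.IsFrobSemisimple) {H₁ : Submodule ℂ V₁} {e₁ : ℕ}
    (h₁ : IsStringHead σ₁ H₁ e₁) (htop₁ : stringSpan σ₁ H₁ e₁ = ⊤) {A B : Submodule ℂ V₂}
    (hA : σ₂.IsSubrep A) (hB : σ₂.IsSubrep B) (hAB : Disjoint A B) (hABtop : A ⊔ B = ⊤) (hA0 : A ≠ ⊥)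
    (hB0 : B ≠ ⊥) (hAd : finrank ℂ A + 1 ≤ n) (hBd : finrank ℂ B + 1 ≤ n)
    (HK : ∀ (Hp : Type) [AddCommGroup Hp] [Module ℂ Hp] [FiniteDimensional ℂ Hp] [Nontrivial Hp]
      (ρ : Representation ℂ (WeilGroup F) Hp) (hρ : WeilGroup.IsContinuousRep ρ), ρ.IsIrreducible →
      (∀ w, Module.End.IsSemisimple (ρ w)) → ∀ d : ℕ, 0 < d → d * finrank ℂ Hp < n →
        finrank ℂ (homWDIn (stringModel ρ hρ d) σ₁ ⊤) = finrank ℂ (homWDIn (stringModel ρ hρ d) σ₂ ⊤)) :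
    False := by
  -- string summands inside `A` and `B` and their socle probes
  obtain ⟨H₂, e₂, C₂, h₂, hS₂A, -, -, -, -⟩ := exists_isStringHead_summand hσ₂ hA hA0
  obtain ⟨H₃, e₃, C₃, h₃, hS₃B, -, -, -, -⟩ := exists_isStringHead_summand hσ₂ hB hB0
  haveI : Nontrivial H₂ := Submodule.nontrivial_iff_ne_bot.mpr h₂.irreducible.1
  haveI : Nontrivial H₃ := Submodule.nontrivial_iff_ne_bot.mpr h₃.irreducible.1
  set ρ₂' := σ₂.ρ.subrepresentation H₂ h₂.irreducible.2.1
  set ρ₃' := σ₂.ρ.subrepresentation H₃ h₃.irreducible.2.1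
  have hρ₂' : WeilGroup.IsContinuousRep ρ₂' := isContinuousRep_subrepresentation σ₂.isContinuous H₂ _
  have hρ₃' : WeilGroup.IsContinuousRep ρ₃' := isContinuousRep_subrepresentation σ₂.isContinuous H₃ _
  have hirr₂' : ρ₂'.IsIrreducible := h₂.irreducible.isIrreducible_subrepresentation
  have hirr₃' : ρ₃'.IsIrreducible := h₃.irreducible.isIrreducible_subrepresentation
  set ρ₂ := twistRep ρ₂' ((e₂ - 1 : ℕ) : ℤ)
  set ρ₃ := twistRep ρ₃' ((e₃ - 1 : ℕ) : ℤ)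
  have hρ₂ : WeilGroup.IsContinuousRep ρ₂ := isContinuousRep_twistRep hρ₂' _
  have hρ₃ : WeilGroup.IsContinuousRep ρ₃ := isContinuousRep_twistRep hρ₃' _
  have hirr₂ : ρ₂.IsIrreducible := isIrreducible_twistRep hirr₂' _
  have hirr₃ : ρ₃.IsIrreducible := isIrreducible_twistRep hirr₃' _
  have hss₂ : ∀ w, Module.End.IsSemisimple (ρ₂ w) := fun w =>
    isSemisimple_twistRep (isSemisimple_subrepresentation H₂ _ (hσ₂ w)) _
  have hss₃ : ∀ w, Module.End.IsSemisimple (ρ₃ w) := fun w =>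
    isSemisimple_twistRep (isSemisimple_subrepresentation H₃ _ (hσ₂ w)) _
  have hdim₂ : 1 * finrank ℂ H₂ < n := by
    have := Submodule.finrank_mono (hS₂A.trans' (le_stringSpan_succ σ₂ H₂ (e₂ - 1) |>.trans_eq (by
      rw [Nat.sub_add_cancel h₂.pos])))
    omega
  have hdim₃ : 1 * finrank ℂ H₃ < n := by
    have := Submodule.finrank_mono (hS₃B.trans' (le_stringSpan_succ σ₂ H₃ (e₃ - 1) |>.trans_eq (by
      rw [Nat.sub_add_cancel h₃.pos])))
    omega
  -- the socle probe of `S₂` counts `1` on `S₂`, hence `≥ 1` on `σ₂`, hence `= 1` on the string `σ₁`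
  have hK22 : finrank ℂ (homWDIn (stringModel ρ₂ hρ₂ 1) σ₂ (stringSpan σ₂ H₂ e₂)) = 1 :=
    (K_stringSpan ρ₂ hρ₂ hirr₂ 1 h₂).1 ⟨e₂ - 1, by have := h₂.pos; omega, isoTw_self_twist ρ₂' _, by omega⟩
  have hK33 : finrank ℂ (homWDIn (stringModel ρ₃ hρ₃ 1) σ₂ (stringSpan σ₂ H₃ e₃)) = 1 :=
    (K_stringSpan ρ₃ hρ₃ hirr₃ 1 h₃).1 ⟨e₃ - 1, by have := h₃.pos; omega, isoTw_self_twist ρ₃' _, by omega⟩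
  have hI : ∀ {Hq : Type} [AddCommGroup Hq] [Module ℂ Hq] [FiniteDimensional ℂ Hq] [Nontrivial Hq]
      (ρ : Representation ℂ (WeilGroup F) Hq) (hρ : WeilGroup.IsContinuousRep ρ), ρ.IsIrreducible →
      (∀ w, Module.End.IsSemisimple (ρ w)) → 1 * finrank ℂ Hq < n →
      1 ≤ finrank ℂ (homWDIn (stringModel ρ hρ 1) σ₂ ⊤) →
      IsoTw (σ₁.ρ.subrepresentation H₁ h₁.irreducible.2.1) ((e₁ - 1 : ℕ) : ℤ) ρ := by
    intro Hq _ _ _ _ ρ hρ hirr hss hlt hge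
    have h1 : finrank ℂ (homWDIn (stringModel ρ hρ 1) σ₁ ⊤) = finrank ℂ (homWDIn (stringModel ρ hρ 1) σ₂ ⊤) :=
      HK Hq ρ hρ hirr hss 1 one_pos hlt
    classical
    have hcond : ∃ i : ℕ, i < e₁ ∧ IsoTw (σ₁.ρ.subrepresentation H₁ h₁.irreducible.2.1) (i : ℤ) ρ ∧ e₁ ≤ 1 + i := by
      by_contra hno
      have := (K_stringSpan ρ hρ hirr 1 h₁).2 hno
      rw [htop₁] at this
      omega
    obtain ⟨i, hi, hiso, hle⟩ := hcond
    obtain rfl : i = e₁ - 1 := by omega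
    exact hiso
  have hI2 := hI ρ₂ hρ₂ hirr₂ hss₂ hdim₂
    (by have := K_mono ρ₂ hρ₂ 1 σ₂ (le_top : stringSpan σ₂ H₂ e₂ ≤ ⊤); omega)
  have hI3 := hI ρ₃ hρ₃ hirr₃ hss₃ hdim₃
    (by have := K_mono ρ₃ hρ₃ 1 σ₂ (le_top : stringSpan σ₂ H₃ e₃ ≤ ⊤); omega)
  have h23 : IsoTw ρ₂ 0 ρ₃ := by
    have := hI2.symm.trans hI3
    rwa [neg_add_cancel] at this
  -- then `ρ₃` counts `≥ 2` on `σ₂ = A ⊕ B` but `≤ 1` on the string `σ₁`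
  have hK23 : finrank ℂ (homWDIn (stringModel ρ₃ hρ₃ 1) σ₂ (stringSpan σ₂ H₂ e₂)) = 1 := by
    refine (K_stringSpan ρ₃ hρ₃ hirr₃ 1 h₂).1 ⟨e₂ - 1, by have := h₂.pos; omega, ?_, by omega⟩
    have := (isoTw_self_twist ρ₂' ((e₂ - 1 : ℕ) : ℤ)).trans h23
    rwa [add_zero] at this
  have hge2 : 2 ≤ finrank ℂ (homWDIn (stringModel ρ₃ hρ₃ 1) σ₂ ⊤) := by
    rw [← hABtop, K_sup ρ₃ hρ₃ 1 σ₂ hA hB hAB]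
    have hA1 := K_mono ρ₃ hρ₃ 1 σ₂ hS₂A
    have hB1 := K_mono ρ₃ hρ₃ 1 σ₂ hS₃B
    omega
  have hle1 : finrank ℂ (homWDIn (stringModel ρ₃ hρ₃ 1) σ₁ ⊤) ≤ 1 := by
    rw [← htop₁]; exact K_stringSpan_le_one ρ₃ hρ₃ hirr₃ 1 h₁
  have h1 := HK H₃ ρ₃ hρ₃ hirr₃ hss₃ 1 one_pos hdim₃
  omega

/-- **Henniart 2002, Thm 1.7 (a), Galois side, invariant form.**  For `n ≥ 2`, Frobenius-semisimple
`σ, σ'` on `ℂ^n` with `σ` not irreducible: if the Weil–Deligne invariants of `σ ⊗ τ` and `σ' ⊗ τ` have the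
same dimension for every indecomposable Frobenius-semisimple `τ` of dimension `r ∈ (0, n)`, then `σ ≅ σ'`.
[cite: HenniartBSMF2002, Thm. 1.7 (a)] -/
theorem isEquivalent_of_finrank_invariants_tprod_eq (hn : 2 ≤ n) (σ σ' : WeilDeligneRep F ℂ (Fin n → ℂ))
    (hσ : σ.IsFrobSemisimple) (hσ' : σ'.IsFrobSemisimple) (hnot : ¬ σ.IsIrreducible)
    (H : ∀ (r : ℕ), 0 < r → r < n → ∀ τ : WeilDeligneRep F ℂ (Fin r → ℂ), τ.IsFrobSemisimple →
      τ.IsIndecomposable → finrank ℂ ↥(LinearMap.ker (σ.tprod τ).N ⊓ (σ.tprod τ).ρ.invariants) =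
        finrank ℂ ↥(LinearMap.ker (σ'.tprod τ).N ⊓ (σ'.tprod τ).ρ.invariants)) :
    σ.IsEquivalent σ' := by
  haveI : Nonempty (Fin n) := ⟨⟨0, by omega⟩⟩
  have hn' : finrank ℂ (Fin n → ℂ) = n := Module.finrank_fin_fun ℂ
  have HKtop : ∀ (Hp : Type) [AddCommGroup Hp] [Module ℂ Hp] [FiniteDimensional ℂ Hp] [Nontrivial Hp]
      (ρ : Representation ℂ (WeilGroup F) Hp) (hρ : WeilGroup.IsContinuousRep ρ), ρ.IsIrreducible →
      (∀ w, Module.End.IsSemisimple (ρ w)) → ∀ d : ℕ, 0 < d → d * finrank ℂ Hp < n →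
        finrank ℂ (homWDIn (stringModel ρ hρ d) σ ⊤) = finrank ℂ (homWDIn (stringModel ρ hρ d) σ' ⊤) :=
    fun Hp _ _ _ _ ρ hρ hirr hss d hd hlt => K_top_eq_of_hyp H Hp ρ hρ hirr hss hd hlt
  have htopσ : σ.IsSubrep ⊤ := ⟨fun _ _ _ => trivial, fun _ _ => trivial⟩
  have htopσ' : σ'.IsSubrep ⊤ := ⟨fun _ _ _ => trivial, fun _ _ => trivial⟩
  by_cases hind : σ.IsIndecomposable
  · -- `σ` is a single string `ρ_H ⊗ Sp(e)` with `e ≥ 2`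
    obtain ⟨H₁, e, h, htop⟩ := exists_string_eq_top_of_isIndecomposable hσ hind
    have he2 : 2 ≤ e := two_le_of_not_isIrreducible h htop hnot
    haveI : Nontrivial H₁ := Submodule.nontrivial_iff_ne_bot.mpr h.irreducible.1
    set ρH := σ.ρ.subrepresentation H₁ h.irreducible.2.1 with hρHdef
    have hρH : WeilGroup.IsContinuousRep ρH := isContinuousRep_subrepresentation σ.isContinuous H₁ _
    have hirrH : ρH.IsIrreducible := h.irreducible.isIrreducible_subrepresentation
    have hssH : ∀ w, Module.End.IsSemisimple (ρH w) := fun w => isSemisimple_subrepresentation H₁ _ (hσ w)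
    have hdim : e * finrank ℂ H₁ = n := by rw [← finrank_stringSpan h, htop, finrank_top, hn']
    have hapos : 0 < finrank ℂ H₁ := finrank_pos
    have ha : 1 * finrank ℂ H₁ < n := by
      have h2 : 2 * finrank ℂ H₁ ≤ e * finrank ℂ H₁ := Nat.mul_le_mul_right _ he2
      omega
    -- the socle probe `ρ_H ⊗ ‖·‖^{e-1}` of dimension `dim H < n`
    set ρs := twistRep ρH ((e - 1 : ℕ) : ℤ) with hρsdef
    have hρs : WeilGroup.IsContinuousRep ρs := isContinuousRep_twistRep hρH _
    have hirrs : ρs.IsIrreducible := isIrreducible_twistRep hirrH _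
    have hsss : ∀ w, Module.End.IsSemisimple (ρs w) := fun w => isSemisimple_twistRep (hssH w) _
    have hKσ : finrank ℂ (homWDIn (stringModel ρs hρs 1) σ ⊤) = 1 := by
      rw [← htop]
      exact (K_stringSpan ρs hρs hirrs 1 h).1 ⟨e - 1, by omega, isoTw_self_twist ρH _, by omega⟩
    have hKσ' : finrank ℂ (homWDIn (stringModel ρs hρs 1) σ' ⊤) = 1 := by
      rw [← HKtop H₁ ρs hρs hirrs hsss 1 one_pos ha]; exact hKσ
    by_cases hirr' : σ'.IsIrreducible
    · -- impossible: the socle probe has dimension `< n = dim σ'`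
      exfalso
      obtain ⟨h', htop'⟩ := isStringHead_top_of_isIrreducible hirr'
      have h0 : finrank ℂ (homWDIn (stringModel ρs hρs 1) σ' (stringSpan σ' ⊤ 1)) = 0 := by
        refine (K_stringSpan ρs hρs hirrs 1 h').2 ?_
        rintro ⟨i, -, hiso, -⟩
        have := finrank_eq_of_isoTw hiso
        rw [finrank_top, hn'] at this
        omega
      rw [htop'] at h0
      omega
    · by_cases hind' : σ'.IsIndecomposable
      · -- `σ'` is a single string with the same socle, hence the same string
        obtain ⟨H', e', h', htop'⟩ := exists_string_eq_top_of_isIndecomposable hσ' hind'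
        haveI : Nontrivial H' := Submodule.nontrivial_iff_ne_bot.mpr h'.irreducible.1
        classical
        have hcond : ∃ i : ℕ, i < e' ∧ IsoTw (σ'.ρ.subrepresentation H' h'.irreducible.2.1) (i : ℤ) ρs ∧
            e' ≤ 1 + i := by
          by_contra hno
          have := (K_stringSpan ρs hρs hirrs 1 h').2 hno
          rw [htop'] at this
          omega
        obtain ⟨i, hi, hiso, hle⟩ := hcond
        obtain rfl : i = e' - 1 := by omega
        have hiso2 := hiso.trans (isoTw_twist_self ρH ((e - 1 : ℕ) : ℤ))
        have hdimH : finrank ℂ H' = finrank ℂ H₁ := finrank_eq_of_isoTw hiso2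
        have hdim' : e' * finrank ℂ H' = n := by rw [← finrank_stringSpan h', htop', finrank_top, hn']
        have hee : e' = e := by
          rw [hdimH] at hdim'
          exact Nat.eq_of_mul_eq_mul_right hapos (hdim'.trans hdim.symm)
        subst hee
        rw [add_neg_cancel] at hiso2
        have hS := isSubrep_stringSpan h.irreducible.2.1 h.le_ker
        have hS' := isSubrep_stringSpan h'.irreducible.2.1 h'.le_ker
        have hSS' : (σ.ofSubrep _ hS).IsEquivalent (σ'.ofSubrep _ hS') :=
          stub_isEquivalent_ofSubrep_stringSpan F _ _ σ σ' H₁ H' _ h h' (nonempty_equiv_of_isoTw_zero hiso2)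
        exact ((isEquivalent_ofSubrep_of_eq_top σ hS htop).symm.trans hSS').trans
          (isEquivalent_ofSubrep_of_eq_top σ' hS' htop')
      · -- `σ'` decomposable: impossible
        exfalso
        obtain ⟨A, B, hA, hB, hAB, hABt, hA0, hB0, hAd, hBd⟩ :=
          exists_decomposition_of_not_isIndecomposable (σ := σ') hind'
        rw [hn'] at hAd hBd
        exact false_of_string_of_decomposable hσ' h htop hA hB hAB hABt hA0 hB0 hAd hBd
          fun Hp _ _ _ _ ρ hρ hirr hss d hd hlt => HKtop Hp ρ hρ hirr hss d hd hlt
  · -- `σ` decomposable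
    obtain ⟨A, B, hA, hB, hAB, hABt, hA0, hB0, hAd, hBd⟩ := exists_decomposition_of_not_isIndecomposable (σ := σ) hind
    rw [hn'] at hAd hBd
    by_cases hdec' : σ'.IsIndecomposable ∨ σ'.IsIrreducible
    · -- `σ'` is a single string: impossible
      exfalso
      obtain ⟨H', e', h', htop'⟩ : ∃ (H' : Submodule ℂ (Fin n → ℂ)) (e' : ℕ) (_ : IsStringHead σ' H' e'),
          stringSpan σ' H' e' = ⊤ := by
        rcases hdec' with hi | hi
        · exact exists_string_eq_top_of_isIndecomposable hσ' hi
        · obtain ⟨h', ht⟩ := isStringHead_top_of_isIrreducible hi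
          exact ⟨⊤, 1, h', ht⟩
      exact false_of_string_of_decomposable hσ h' htop' hA hB hAB hABt hA0 hB0 hAd hBd
        fun Hp _ _ _ _ ρ hρ hirr hss d hd hlt => (HKtop Hp ρ hρ hirr hss d hd hlt).symm
    · -- both decomposable: the counts stabilise beyond the admissible range; reconstruction
      simp only [not_or] at hdec'
      obtain ⟨A', B', hA', hB', hAB', hABt', hA0', hB0', hAd', hBd'⟩ :=
        exists_decomposition_of_not_isIndecomposable (σ := σ') hdec'.1
      rw [hn'] at hAd' hBd'
      have HKall : ∀ (Hp : Type) [AddCommGroup Hp] [Module ℂ Hp] [FiniteDimensional ℂ Hp] [Nontrivial Hp]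
          (ρ : Representation ℂ (WeilGroup F) Hp) (hρ : WeilGroup.IsContinuousRep ρ), ρ.IsIrreducible →
          (∀ w, Module.End.IsSemisimple (ρ w)) → ∀ d : ℕ,
            finrank ℂ (homWDIn (stringModel ρ hρ d) σ ⊤) = finrank ℂ (homWDIn (stringModel ρ hρ d) σ' ⊤) := by
        intro Hp _ _ _ _ ρ hρ hirr hss d
        rcases Nat.eq_zero_or_pos d with rfl | hd
        · rw [K_len_zero, K_len_zero]
        have stab : ∀ {W : Type} [AddCommGroup W] [Module ℂ W] [FiniteDimensional ℂ W]
            {τσ : WeilDeligneRep F ℂ W}, τσ.IsFrobSemisimple → ∀ {P Q : Submodule ℂ W}, τσ.IsSubrep P →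
            τσ.IsSubrep Q → Disjoint P Q → P ⊔ Q = ⊤ → finrank ℂ P + 1 ≤ n → finrank ℂ Q + 1 ≤ n →
            ∀ d₁ d₂ : ℕ, (n - 1) / finrank ℂ Hp ≤ d₁ → (n - 1) / finrank ℂ Hp ≤ d₂ →
              finrank ℂ (homWDIn (stringModel ρ hρ d₁) τσ ⊤) = finrank ℂ (homWDIn (stringModel ρ hρ d₂) τσ ⊤) := by
          intro W _ _ _ τσ hτσ P Q hP hQ hPQ hPQt hPd hQd d₁ d₂ hd₁ hd₂
          rw [← hPQt, K_sup ρ hρ d₁ τσ hP hQ hPQ, K_sup ρ hρ d₂ τσ hP hQ hPQ,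
            K_stable hτσ ρ hρ hirr (n - 1) _ P rfl hP (by omega) d₁ d₂ hd₁ hd₂,
            K_stable hτσ ρ hρ hirr (n - 1) _ Q rfl hQ (by omega) d₁ d₂ hd₁ hd₂]
        set D := (n - 1) / finrank ℂ Hp with hD
        have hDle : D * finrank ℂ Hp ≤ n - 1 := Nat.div_mul_le_self (n - 1) (finrank ℂ Hp)
        by_cases hdD : d ≤ D
        · refine HKtop Hp ρ hρ hirr hss d hd ?_
          have h1 : d * finrank ℂ Hp ≤ D * finrank ℂ Hp := Nat.mul_le_mul_right _ hdD
          omega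
        · have hDd : D ≤ d := by omega
          rcases Nat.eq_zero_or_pos D with hD0 | hDpos
          · rw [stab hσ hA hB hAB hABt hAd hBd d 0 hDd (by omega), stab hσ' hA' hB' hAB' hABt' hAd' hBd' d 0 hDd
              (by omega), K_len_zero, K_len_zero]
          · rw [stab hσ hA hB hAB hABt hAd hBd d D hDd le_rfl, stab hσ' hA' hB' hAB' hABt' hAd' hBd' d D hDd le_rfl]
            refine HKtop Hp ρ hρ hirr hss D hDpos ?_
            omega
      have hrec := isEquivalent_ofSubrep_of_K_eq hσ hσ' _ ⊤ ⊤ htopσ htopσ' rfl HKall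
      exact ((isEquivalent_ofSubrep_top σ htopσ).symm.trans hrec).trans (isEquivalent_ofSubrep_top σ' htopσ')

end Final

/-- **Registered stub S-17a-B `stub_isEquivalent_of_finrank_invariants_tprod_eq` (Henniart 2002,
Thm 1.7 (a), Galois side, INVARIANT FORM).**  Let `n ≥ 2`, let `σ` be a Frobenius-semisimple
`n`-dimensional Weil–Deligne representation which is NOT irreducible and `σ'` a Frobenius-semisimple
`n`-dimensional one.  If for every indecomposable Frobenius-semisimple `τ` of dimension `r`, `1 ≤ r ≤ n - 1`,
the Weil–Deligne invariants `ker N ⊓ (·)^{W_F}` of `σ ⊗ τ` and of `σ' ⊗ τ` have the same dimension, then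
`σ ≅ σ'`. [cite: HenniartBSMF2002, Thm. 1.7 (a)] -/
theorem stub_isEquivalent_of_finrank_invariants_tprod_eq : ∀ (F : Type) [Field F] [ValuativeRel F] [TopologicalSpace F] [IsNonarchimedeanLocalField F] (n : ℕ), 2 ≤ n → ∀ (σ σ' : WeilDeligneRep F ℂ (Fin n → ℂ)), σ.IsFrobSemisimple → σ'.IsFrobSemisimple → ¬ σ.IsIrreducible → (∀ (r : ℕ), 0 < r → r < n → ∀ τ : WeilDeligneRep F ℂ (Fin r → ℂ), τ.IsFrobSemisimple → τ.IsIndecomposable → Module.finrank ℂ ↥(LinearMap.ker (σ.tprod τ).N ⊓ (σ.tprod τ).ρ.invariants) = Module.finrank ℂ ↥(LinearMap.ker (σ'.tprod τ).N ⊓ (σ'.tprod τ).ρ.invariants)) → σ.IsEquivalent σ' :=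
  fun _ _ _ _ _ _ hn σ σ' hσ hσ' hnot H => isEquivalent_of_finrank_invariants_tprod_eq hn σ σ' hσ hσ' hnot H

/-- **Henniart 2002, Thm 1.7 (a), Galois side, DISCHARGED** (registered sub-goal `stub_henniart2002_thm17a_holds`):
the Literature named fact `Henniart2002_isEquivalent_of_rootMultiplicity_eulerFactor_tprod_eq F` for every
non-archimedean local field `F` — pole orders are invariant dimensions (stub S-17a-A,
`stub_rootMultiplicity_eulerFactor_tprod_eq_finrank`, `…RPoleOrderInvariants`) and those determine `σ` (stub S-17a-B
above).  A Literature file cannot import `Summits.*`, so the discharge lives here. [cite: HenniartBSMF2002, Thm. 1.7 (a)] -/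
theorem stub_henniart2002_thm17a_holds : ∀ (F : Type) [Field F] [ValuativeRel F] [TopologicalSpace F] [IsNonarchimedeanLocalField F], Henniart2002_isEquivalent_of_rootMultiplicity_eulerFactor_tprod_eq F := by
  intro F _ _ _ _ hn hex n hn2 σ σ' hσ hσ' hirr H
  refine stub_isEquivalent_of_finrank_invariants_tprod_eq F n hn2 σ σ' hσ hσ' hirr ?_
  intro r hr hrn τ hτ hτi
  rw [← stub_rootMultiplicity_eulerFactor_tprod_eq_finrank F hn hex _ _ σ τ hσ hτ,
    ← stub_rootMultiplicity_eulerFactor_tprod_eq_finrank F hn hex _ _ σ' τ hσ' hτ]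
  exact H r hr hrn τ hτ hτi

/-- The discharge under the Literature-style name. [cite: HenniartBSMF2002, Thm. 1.7 (a)] -/
theorem henniart2002_isEquivalent_of_rootMultiplicity_eulerFactor_tprod_eq_holds (F : Type) [Field F]
    [ValuativeRel F] [TopologicalSpace F] [IsNonarchimedeanLocalField F] :
    Henniart2002_isEquivalent_of_rootMultiplicity_eulerFactor_tprod_eq F :=
  stub_henniart2002_thm17a_holds F

end Summit.Langlands.Langlands.Theorems.ReciprocityUpToIrreducibilityR

end
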